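import Summits.BirchSwinnertonDyer.BirchSwinnertonDyer.Theorems.ByReductionTypeAtTwoOrdKatoHalfAtTwoIsoResidueConj
import Summits.BirchSwinnertonDyer.BirchSwinnertonDyer.Theorems.SmallImageMuTransferMuTransferX9CentralScalar
import Summits.BirchSwinnertonDyer.BirchSwinnertonDyer.Theorems.SmallImageMuTransferMuTransferX9StepFourReciprocity
import Literature.NumberTheory.GaloisRepresentations.AbsGaloisRestrictRealPlace
import Literature.NumberTheory.GaloisRepresentations.ContinuousH1OrderTwo
import Literature.NumberTheory.IwasawaTheory.ClassicalMuInvariantOnePrimeProofs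
import HarnessLib

/-!
# Route ByReductionTypeAtTwo, crux `OrdKatoHalfAtTwoIso` (stmt-BirchSwinnertonDyer-19573), line
# `steinberg-fibre-at-two` v4: helper W3a — the REAL PLACE at `p = 2`:
# `H¹(ℝ, 𝒯_J(E)) = 0` when `Δ(E) < 0` (device (Δ); PORT-MAP site P5)

HONEST FRAMING (cell bsd-2adic): BSD is not proved by any of this; the crux `OrdKatoHalfAtTwoIso` is NOT
proved here; `stub_port` is not proved; nothing is booked. This file is a KERNEL HELPER for the line
`Cruxes/OrdKatoHalfAtTwoIso/Lines/steinberg_fibre_at_two.lean` (`--supports … --as helper`; it is not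
one of the line's registered stubs). It proves the two real-place statements typed by the side seats —
sidea-stub_port-1 H14/H15 (`StubPortHelpersAtTwo.lean`) and sidea-stub_port-2 H-R/H-R′
(`STUB_IDEAS_stub_port_2_Helpers.lean`) — which replace, at `p = 2`, the one place of MU-TRANSFER-PROOF
§5 STEP 4 where `p` odd was used (`StepFour.localization_inl_eq_zero_of_odd`: «`v = ∞`: nothing, `p` odd»).

Mathematics. Let `G = {1, c}` act on an abelian group `X`. A crossed homomorphism `φ : G → X` has
`φ(c) + cφ(c) = φ(c²) = 0`, so `H¹(G, X) = ker(1 + c)/im(c − 1)`; hence `H¹(G, X) = 0` as soon as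
`ker(1 + c) ⊆ im(c − 1)` (§1, `discreteH1_eq_zero_of_natCard_le_two_of_ker_le_range`, for Mathlib's
`continuousCohomology 1` of a `TopRep` and `|G| ≤ 2`). On `E[2] = {0, T₀, T₁, T₂}` a TRANSPOSITION `t`
(fixing `T_i`, swapping `T_j`, `T_k`) has `ker(1 + t) = {0, T_i}` and `t T_j − T_j = T_k + T_j = T_i`, so
`ker(1 + t) = im(t − 1)` (§2, `exists_eq_smul_sub_of_add_smul_eq_zero_of_sign_eq_neg_one`; i.e. `E[2]`
is the regular `𝔽₂[⟨t⟩]`-module). For `E/ℚ` with `Δ < 0`, a real place `w` of `ℚ` and ANY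
`ℤ₂`-extension `κ` of `ℚ`: the non-trivial element of `Γ_{ℚ_w} = Gal(ℂ/ℝ)` restricts to a complex
conjugation `c ∈ Γ_ℚ` (tree `isComplexConjugationAt_absGaloisRestrict_of_ne_one`), which lies in `ker κ`
(an involution has trivial image in the torsion-free `ℤ₂`; tree
`ZpExtension.mem_kerSubgroup_of_isComplexConjugation` — no cyclotomic hypothesis), so acts on
`𝒯_J(E) = E[2] ⊗ 𝔽₂[T]/(T^J)(χ_κ)` SLOTWISE (`modPTwist_apply_of_mem_kerSubgroup`), and on each slot
as a transposition (`sign_permGal_eq_neg_one_of_isComplexConjugation_of_Δ_neg`, the line's helper W-Δ).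
Hence `H¹(ℚ_w, 𝒯_J(E)) = 0` and every localisation at `Sum.inl w` vanishes (§3,
`localization_inl_modPTwist_two_eq_zero_of_Δ_neg` = H14 = H-R, for every `κ`, in particular for the
dual twist `κ.invTwist`; the verbatim sidea-1 binder form with `κ.IsCyclotomic` is
`localization_inl_modPTwist_eq_zero_of_Δ_neg`). §4 is STEP 4 (reciprocity) with the archimedean
vanishing as a HYPOTHESIS `hinf` instead of `Odd n` (H15 = H-R′, adapted from sidea-stub_port-1's proved
`StepFour.localTerm_inr_eq_zero_of_unramified_outside_set_of_inl`), and its `p = 2` instance on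
`𝒯_J(E)` with `hinf` discharged by §3 (`StepFour.localTerm_inr_eq_zero_of_unramified_outside_set_two`).

All sorry-free; no definition, no named fact, no instance (the `p = 2` instance of §4 takes `E[2]` finite
as an instance hypothesis, as the tree's `…X9StepFourModPTwist` does; discharge it with
`finite_geomTorsion_of_neZero W 2` / `finite_torsionPoints_holds`).

References: J.-P. Serre, *Galois Cohomology* (1997), I §2.4 (the case `G = Gal(ℂ/ℝ)`), II §6.1
[SerreGaloisCohomology1997]; J.-P. Serre, *Local Fields* (1979), VIII §4 (cohomology of finite cyclic
groups) [SerreLocalFields1979]; J. S. Milne, *Arithmetic Duality Theorems* (2006), I Thm. 4.10 (b),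
Rem. 3.7 [MilneADT2006]; L. C. Washington, GTM 83, §13.1 [Washington1997]; J. H. Silverman, *AEC*
(2009), III.6.4 (b), III.§7 [SilvermanAEC2009].
-/

set_option autoImplicit false
set_option linter.dupNamespace false

noncomputable section

open Field WeierstrassCurve Function NumberField IsDedekindDomain
open scoped NumberField
open Literature.NumberTheory.EllipticCurves Literature.NumberTheory.GaloisRepresentations
open Literature.NumberTheory.GaloisCohomology
open Literature.NumberTheory.EllipticCurves.DokchitserDokchitser2012

universe u v

/-! ## §1 Generic engine: `ker(1 + c) ⊆ im(c − 1)` ⇒ `H¹(G, X) = 0` for `|G| ≤ 2` -/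

namespace Summit.BirchSwinnertonDyer.BirchSwinnertonDyer.Rank1Residual

section Engine

open _root_.TopRep

variable {R : Type u} [Ring R] [TopologicalSpace R]
variable {G : Type v} [Group G] [TopologicalSpace G] [IsTopologicalGroup G] [Finite G]

/-- **`H¹(G, X) = 0` for a group of order `≤ 2` whenever `ker(1 + c) ⊆ im(c − 1)`** (character-free).
For a topological group `G` with `|G| ≤ 2`, any topological representation `X`, and the non-trivial
`c ∈ G` (if any): if every `m ∈ X` with `m + c m = 0` is of the form `c q − q`, then every class of
Mathlib's `continuousCohomology 1 X` vanishes. Proof: a continuous crossed homomorphism `φ` has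
`φ(c) + cφ(c) = φ(c²) = φ(1) = 0`, so `φ(c) = cQ − Q`, and then `φ` is the coboundary of `Q`
(`φ(1) = 0 = 1·Q − Q`); for `G = 1`, `φ = 0`. (The tree's `discreteH1_eq_zero_of_natCard_le_two`
is the case where the hypothesis comes from `2`-divisibility; here it is the hypothesis itself.)
[cite: SerreGaloisCohomology1997, I §2.4 (the case G = Gal(ℂ/ℝ))]
[cite: SerreLocalFields1979, VIII §4 (cohomology of finite cyclic groups)] -/
theorem discreteH1_eq_zero_of_natCard_le_two_of_ker_le_range (hG : Nat.card G ≤ 2)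
    (X : TopRep.{v} R G)
    (hker : ∀ c : G, c ≠ 1 → ∀ m : X, m + X.ρ c m = 0 → ∃ q : X, m = X.ρ c q - q)
    (x : continuousCohomology 1 X) : x = 0 := by
  obtain ⟨φ, rfl⟩ := oneCocycleClass_surjective X x
  rw [oneCocycleClass_eq_zero_iff]
  by_cases h1 : ∃ c : G, c ≠ 1
  · obtain ⟨c, hc⟩ := h1
    have hcc : c * c = 1 := mul_self_eq_one_of_natCard_le_two hG c
    -- `φ(c) + c φ(c) = φ(c²) = φ(1) = 0`
    have hP : φ.1 c + X.ρ c (φ.1 c) = 0 := by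
      have h := φ.2 c c
      rw [hcc, contOneCocycles.apply_one] at h
      exact h.symm
    obtain ⟨Q, hQ⟩ := hker c hc (φ.1 c) hP
    refine ⟨Q, fun σ => ?_⟩
    rcases eq_or_ne σ 1 with rfl | hσ
    · rw [contOneCocycles.apply_one, _root_.map_one X.ρ]
      exact (sub_self Q).symm
    · rw [eq_of_ne_one_of_natCard_le_two hG hσ hc]
      exact hQ
  · push Not at h1
    refine ⟨0, fun σ => ?_⟩
    rw [h1 σ, contOneCocycles.apply_one, map_zero, sub_zero]

end Engine

end Summit.BirchSwinnertonDyer.BirchSwinnertonDyer.Rank1Residual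

/-! ## §2 The slot lemma on `E[2]`: for a transposition `t`, `ker(1 + t) = im(t − 1)` -/

namespace Summit.BirchSwinnertonDyer.BirchSwinnertonDyer.Theorems.SteinbergFibreAtTwo

/-- An ODD permutation `g` of three letters is a transposition: if it fixes `i` then some `j ≠ i` is
moved to the third letter, and in `(ℤ/2)²` the corresponding frame vectors satisfy
`v_{g j} + v_j = v_i` (`v₀ + v₁ + v₂ = 0`). A decidable fact about `S₃`. [folklore] -/
theorem perm_fin_three_exists_of_sign_eq_neg_one_of_apply_eq :
    ∀ g : Equiv.Perm (Fin 3), Equiv.Perm.sign g = -1 → ∀ i : Fin 3, g i = i →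
      ∃ j : Fin 3, j ≠ i ∧ g j ≠ j ∧ vec (g j) + vec j = vec i := by
  decide

section Slot

variable (W : WeierstrassCurve ℚ) [W.IsElliptic]

omit [W.IsElliptic] in
/-- In `E[2]` every element is its own negative. [cite: SilvermanAEC2009, III.§6 (definition of E[m])] -/
theorem neg_eq_self_geomTorsion_two (P : geomTorsion W 2) : -P = P := by
  rw [neg_eq_iff_add_eq_zero]
  exact Subtype.ext (coe_add_self_eq_zero W P)

/-- In the frame `E[2] ≅ (ℤ/2)²`, the letter `T_i` is the vector `v_i` (unfolding of the tree's `T`).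
[cite: SilvermanAEC2009, Cor. III.6.4(b) (E[m] ≅ ℤ/mℤ × ℤ/mℤ)] -/
theorem frame_T_eq_vec (i : Fin 3) :
    frame W (two_ne_zero : (2 : ℚ) ≠ 0) (T W two_ne_zero i) = vec i := by
  rw [T, AddEquiv.apply_symm_apply]

/-- **The slot lemma: on `E[2]`, a transposition `c` has `ker(1 + c) ⊆ im(c − 1)`.** For an elliptic
`W/ℚ` and `c ∈ Γ_ℚ` inducing an ODD permutation of `{T₀, T₁, T₂}` (a transposition, e.g. complex
conjugation when `Δ < 0`): every `m ∈ E[2]` with `m + c m = 0` is `c q − q` for some `q ∈ E[2]`.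
Indeed `E[2] = {0, T₀, T₁, T₂}`; `m = T_i` with `T_i + T_{c(i)} = 0` forces `c(i) = i` (the `T`'s are
distinct and `−T = T`), i.e. `T_i` is the fixed letter; and for a moved letter `j`,
`c T_j − T_j = T_{c(j)} + T_j = T_i` (`T₀ + T₁ + T₂ = 0`). Equivalently `E[2] ≅ 𝔽₂[⟨c⟩]` is induced, so
both Tate cohomology groups of `⟨c⟩` on it vanish. [cite: SilvermanAEC2009, Cor. III.6.4(b)]
[cite: SerreLocalFields1979, VIII §4 (cohomology of finite cyclic groups)] -/
theorem exists_eq_smul_sub_of_add_smul_eq_zero_of_sign_eq_neg_one {c : Field.absoluteGaloisGroup ℚ}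
    (hc : Equiv.Perm.sign (permGal W (two_ne_zero : (2 : ℚ) ≠ 0) c) = -1) (m : geomTorsion W 2)
    (hm : m + c • m = 0) : ∃ q : geomTorsion W 2, m = c • q - q := by
  have h2 : (2 : ℚ) ≠ 0 := two_ne_zero
  rcases eq_zero_or_eq_T W h2 m with rfl | ⟨i, rfl⟩
  · exact ⟨0, by rw [smul_zero, sub_zero]⟩
  · -- `T_i + T_{c(i)} = 0` forces `c(i) = i`
    have hgi : permGal W h2 c i = i := by
      by_contra hne
      rw [← T_permGal] at hm
      have h : T W h2 (permGal W h2 c i) = T W h2 i := by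
        rw [← neg_eq_self_geomTorsion_two W (T W h2 i)]
        exact eq_neg_of_add_eq_zero_right hm
      exact hne (T_injective W h2 h)
    obtain ⟨j, -, -, hvec⟩ := perm_fin_three_exists_of_sign_eq_neg_one_of_apply_eq _ hc i hgi
    refine ⟨T W h2 j, ?_⟩
    rw [← T_permGal, sub_eq_add_neg, neg_eq_self_geomTorsion_two]
    apply (frame W h2).injective
    rw [map_add, frame_T_eq_vec, frame_T_eq_vec, frame_T_eq_vec, hvec]

end Slot

end Summit.BirchSwinnertonDyer.BirchSwinnertonDyer.Theorems.SteinbergFibreAtTwo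

/-! ## §3 H14 = H-R: `H¹(ℚ_w, 𝒯_J(E)) = 0` at the real place when `Δ < 0`, for every `ℤ₂`-extension -/

namespace Summit.BirchSwinnertonDyer.BirchSwinnertonDyer.Rank1Residual

open Summit.BirchSwinnertonDyer.BirchSwinnertonDyer.Theorems

section RealPlace

variable (W : WeierstrassCurve ℚ) [W.IsElliptic] (κ : ZpExtension ℚ 2)

/-- **`H¹(ℚ_w, 𝒯_J(E)) = 0` at an infinite place `w` of `ℚ` when `Δ(E) < 0`, for EVERY `ℤ₂`-extension
`κ`.** Every class of the local Galois cohomology `H¹` of `(W.modPTwist 2 κ J).toLocal (Sum.inl w)`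
vanishes: `Γ_{ℚ_w}` has order `≤ 2`; its non-trivial element restricts to a complex conjugation
`c ∈ Γ_ℚ` at the (real) place `w`, `c ∈ ker κ` (an involution dies in `ℤ₂`), so `c` acts on `𝒯_J(E)`
slotwise through `E[2]`, where it is a transposition (`Δ < 0`); §2 slotwise gives `ker(1 + c) ⊆ im(c − 1)`
and §1 concludes. [cite: SerreGaloisCohomology1997, I §2.4 (the case G = Gal(ℂ/ℝ))]
[cite: Washington1997, §13.1 Prop. 13.2] -/
theorem galoisCohomology_toLocal_inl_modPTwist_two_eq_zero_of_Δ_neg (hΔ : W.Δ < 0) (J : ℕ)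
    (w : InfinitePlace ℚ) (x : galoisCohomology ((W.modPTwist 2 κ J).toLocal (Sum.inl w)) 1) :
    x = 0 := by
  haveI : Finite (absoluteGaloisGroup (Place.Completion (Sum.inl w))) :=
    finite_absoluteGaloisGroup_completion_infinitePlace w
  have hG : Nat.card (absoluteGaloisGroup (Place.Completion (Sum.inl w))) ≤ 2 :=
    natCard_absoluteGaloisGroup_completion_infinitePlace_le_two w
  have hw : w.IsReal := IsTotallyReal.isReal w
  refine discreteH1_eq_zero_of_natCard_le_two_of_ker_le_range hG
    ((W.modPTwist 2 κ J).toLocal (Sum.inl w)).toTopRep (fun σ hσ m hm => ?_) x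
  -- `c := res σ ∈ Γ_ℚ` is a complex conjugation at `w`, lies in `ker κ`, and is odd on `{T₀, T₁, T₂}`
  have hc : IsComplexConjugationAt hw (absGaloisRestrict ℚ w.Completion σ) :=
    isComplexConjugationAt_absGaloisRestrict_of_ne_one hw hσ
  have hker : absGaloisRestrict ℚ w.Completion σ ∈ κ.kerSubgroup :=
    κ.mem_kerSubgroup_of_isComplexConjugation hc
  have hsign := SteinbergFibreAtTwo.sign_permGal_eq_neg_one_of_isComplexConjugation_of_Δ_neg W hc hΔ
  -- `σ` acts on `𝒯_J(E)` slotwise through `c`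
  have hρ : ∀ y : ((W.modPTwist 2 κ J).toLocal (Sum.inl w)).toTopRep,
      ((W.modPTwist 2 κ J).toLocal (Sum.inl w)).toTopRep.ρ σ y =
        fun i => absGaloisRestrict ℚ w.Completion σ • y i := fun y => by
    change W.modPTwist 2 κ J (absGaloisRestrict ℚ w.Completion σ) y = _
    exact modPTwist_apply_of_mem_kerSubgroup W 2 κ J hker y
  have hm' : ∀ i, m i + absGaloisRestrict ℚ w.Completion σ • m i = 0 := fun i => by
    have h := congrFun hm i
    rw [hρ m, Pi.add_apply] at h
    exact h
  choose q hq using fun i =>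
    SteinbergFibreAtTwo.exists_eq_smul_sub_of_add_smul_eq_zero_of_sign_eq_neg_one W hsign (m i) (hm' i)
  refine ⟨fun i => q i, ?_⟩
  rw [hρ]
  funext i
  rw [Pi.sub_apply]
  exact hq i

/-- **H14 = H-R (device (Δ), the real place at `p = 2`): every localisation at an infinite place of a
class of `H¹(ℚ, 𝒯_J(E))` vanishes when `Δ(E) < 0`, for EVERY `ℤ₂`-extension `κ`** (in particular for
the dual twist `κ.invTwist`). Replaces `StepFour.localization_inl_eq_zero_of_odd` at `p = 2` on the
habitat `Δ < 0`. [cite: SerreGaloisCohomology1997, I §2.4 (the case G = Gal(ℂ/ℝ))]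
[cite: MilneADT2006, Ch. I, Rem. 3.7] -/
theorem localization_inl_modPTwist_two_eq_zero_of_Δ_neg (hΔ : W.Δ < 0) (J : ℕ) (w : InfinitePlace ℚ)
    (x : galoisCohomology (W.modPTwist 2 κ J) 1) :
    galoisCohomology.localization (W.modPTwist 2 κ J) (Sum.inl w) 1 x = 0 :=
  galoisCohomology_toLocal_inl_modPTwist_two_eq_zero_of_Δ_neg W κ hΔ J w _

/-- **H14 in the verbatim binder shape of sidea-stub_port-1** (`hκ : κ.IsCyclotomic` is carried but not
used: complex conjugation lies in `ker κ` for every `ℤ₂`-extension `κ`).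
[cite: SerreGaloisCohomology1997, I §2.4 (the case G = Gal(ℂ/ℝ))] -/
theorem localization_inl_modPTwist_eq_zero_of_Δ_neg (hκ : κ.IsCyclotomic) (hΔ : W.Δ < 0) (J : ℕ)
    (w : InfinitePlace ℚ) (x : galoisCohomology (W.modPTwist 2 κ J) 1) :
    galoisCohomology.localization (W.modPTwist 2 κ J) (Sum.inl w) 1 x = 0 := by
  have _ := hκ
  exact localization_inl_modPTwist_two_eq_zero_of_Δ_neg W κ hΔ J w x

end RealPlace

/-! ## §4 H15 = H-R′: STEP 4 (reciprocity) with the archimedean vanishing as a hypothesis; `p = 2` -/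

-- adapted from run/shared/lean/pub/bsd-2adic/sidea-stub_port-1/StubPortHelpersAtTwo.lean:317–353
-- (sidea-stub_port-1, H15, proved there), universes generalised to `u`
/-- **H15 = H-R′ (STEP 4 with the archimedean vanishing as a HYPOTHESIS; `p`-generic refactor of
`StepFour.localTerm_inr_eq_zero_of_unramified_outside_set`, whose `Odd n` is used ONLY at `Sum.inl w`).**
`inv` a family of local invariant maps with the Poitou–Tate vanishing, `M` finite discrete killed by
`n`, `S` a set of finite places, `q` a finite place; if every localisation of `x` at an infinite place
vanishes (`hinf`), `loc_v x`, `loc_v y` are unramified at every finite `v ∉ S`, `v ≠ q` where inertia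
fixes `M` and `M^D`, and the local terms vanish on `S`, then the local term at `q` vanishes. At `n = 2`
on `𝒯_J(E)`, `Δ < 0`, the hypothesis `hinf` is H14. [cite: MilneADT2006, Ch. I, Thm. 4.10(b)] -/
theorem StepFour.localTerm_inr_eq_zero_of_unramified_outside_set_of_inl
    {K : Type u} [Field K] [NumberField K]
    {M : Type u} [AddCommGroup M] [TopologicalSpace M] [DiscreteTopology M] [Finite M] {n : ℕ}
    [NeZero n] {inv : LocalInvariants K n} (hPT : inv.SumLocalTermEqZero) (ρ : DiscreteGaloisModule K M)
    (hM : ∀ m : M, n • m = 0)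
    (hinf : ∀ (w : InfinitePlace K) (x : galoisCohomology ρ 1),
      galoisCohomology.localization ρ (Sum.inl w) 1 x = 0)
    (S : Set (HeightOneSpectrum (𝓞 K))) (q : HeightOneSpectrum (𝓞 K))
    (x : galoisCohomology ρ 1) (y : galoisCohomology (ρ.tateDual n) 1)
    (hI : ∀ v ∉ S, v ≠ q → ∀ t ∈ absInertia (v.adicCompletion K), ∀ m : M,
      GaloisRep.toLocal v ρ t m = m)
    (hID : ∀ v ∉ S, v ≠ q → ∀ t ∈ absInertia (v.adicCompletion K),
      ∀ f : DiscreteGaloisModule.TateDual K M n, GaloisRep.toLocal v (ρ.tateDual n) t f = f)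
    (hx : ∀ v ∉ S, v ≠ q → galoisCohomology.localization ρ (Sum.inr v) 1 x ∈
      DiscreteGaloisModule.unramifiedSubgroup (GaloisRep.toLocal v ρ) 1)
    (hy : ∀ v ∉ S, v ≠ q → galoisCohomology.localization (ρ.tateDual n) (Sum.inr v) 1 y ∈
      DiscreteGaloisModule.unramifiedSubgroup (GaloisRep.toLocal v (ρ.tateDual n)) 1)
    (hS : ∀ v ∈ S, inv.localTerm ρ (Sum.inr v) x y = 0) :
    inv.localTerm ρ (Sum.inr q) x y = 0 := by
  classical
  refine hPT.localTerm_eq_zero ρ hM x y (Sum.inr q) fun v hv => ?_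
  rcases v with w | v
  · exact StepFour.localTerm_eq_zero_of_localization_left_eq_zero inv ρ (Sum.inl w) (hinf w x) y
  · by_cases hvS : v ∈ S
    · exact hS v hvS
    · have hvq : v ≠ q := fun h => hv (by rw [h])
      exact StepFour.localTerm_inr_eq_zero_of_mem_unramifiedSubgroup inv ρ v (hI v hvS hvq)
        (hID v hvS hvq) (hx v hvS hvq) (hy v hvS hvq)

section RatTwo

variable (W : WeierstrassCurve ℚ) [W.IsElliptic] (κ : ZpExtension ℚ 2)

omit [W.IsElliptic] in
/-- `𝒯_J(E)` at `p = 2` is killed by `2` (slotwise `E[2]`). [cite: Washington1997, §13.1–§13.2] -/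
theorem two_nsmul_modPTwist_two_eq_zero (J : ℕ) (m : Fin J → geomTorsion W ((2 : ℕ) : ℤ)) :
    2 • m = 0 := by
  funext i
  rw [Pi.smul_apply, Pi.zero_apply]
  exact AddSubgroup.torsionBy.nsmul (m i)

/-- **STEP 4 (reciprocity) at `p = 2` on `𝒯_J(E) = W.modPTwist 2 κ J`, `Δ(E) < 0`, ANY `ℤ₂`-extension
`κ` (so also the dual twist `κ.invTwist`).** For a family `inv : LocalInvariants ℚ 2` with the
Poitou–Tate vanishing, a set `S` of finite places and a finite place `q`: if `x ∈ H¹(ℚ, 𝒯_J(E))` and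
`y ∈ H¹(ℚ, 𝒯_J(E)^D)` have unramified localisations at every finite `v ∉ S`, `v ≠ q` at which inertia
fixes `𝒯_J(E)` and its Tate dual, and the local terms vanish on `S`, then the local term at `q` vanishes —
the real place contributes nothing by H14 (`localization_inl_modPTwist_two_eq_zero_of_Δ_neg`), NOT by
oddness of the level. (`E[2]` finite is an instance hypothesis, needed to speak of the Tate dual; discharge
it with the tree's `finite_geomTorsion_of_neZero W 2`.) [cite: MilneADT2006, Ch. I, Thm. 4.10(b)] -/
theorem StepFour.localTerm_inr_eq_zero_of_unramified_outside_set_two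
    [Finite (geomTorsion W ((2 : ℕ) : ℤ))] (hΔ : W.Δ < 0) (J : ℕ)
    {inv : LocalInvariants ℚ 2} (hPT : inv.SumLocalTermEqZero)
    (S : Set (HeightOneSpectrum (𝓞 ℚ))) (q : HeightOneSpectrum (𝓞 ℚ))
    (x : galoisCohomology (W.modPTwist 2 κ J) 1)
    (y : galoisCohomology ((W.modPTwist 2 κ J).tateDual 2) 1)
    (hI : ∀ v ∉ S, v ≠ q → ∀ t ∈ absInertia (v.adicCompletion ℚ),
      ∀ m : Fin J → geomTorsion W ((2 : ℕ) : ℤ), GaloisRep.toLocal v (W.modPTwist 2 κ J) t m = m)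
    (hID : ∀ v ∉ S, v ≠ q → ∀ t ∈ absInertia (v.adicCompletion ℚ),
      ∀ f : DiscreteGaloisModule.TateDual ℚ (Fin J → geomTorsion W ((2 : ℕ) : ℤ)) 2,
        GaloisRep.toLocal v ((W.modPTwist 2 κ J).tateDual 2) t f = f)
    (hx : ∀ v ∉ S, v ≠ q → galoisCohomology.localization (W.modPTwist 2 κ J) (Sum.inr v) 1 x ∈
      DiscreteGaloisModule.unramifiedSubgroup (GaloisRep.toLocal v (W.modPTwist 2 κ J)) 1)
    (hy : ∀ v ∉ S, v ≠ q →
      galoisCohomology.localization ((W.modPTwist 2 κ J).tateDual 2) (Sum.inr v) 1 y ∈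
        DiscreteGaloisModule.unramifiedSubgroup (GaloisRep.toLocal v ((W.modPTwist 2 κ J).tateDual 2)) 1)
    (hS : ∀ v ∈ S, inv.localTerm (W.modPTwist 2 κ J) (Sum.inr v) x y = 0) :
    inv.localTerm (W.modPTwist 2 κ J) (Sum.inr q) x y = 0 :=
  StepFour.localTerm_inr_eq_zero_of_unramified_outside_set_of_inl hPT (W.modPTwist 2 κ J)
    (two_nsmul_modPTwist_two_eq_zero W J)
    (fun w x' => localization_inl_modPTwist_two_eq_zero_of_Δ_neg W κ hΔ J w x') S q x y hI hID hx hy hS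

end RatTwo

end Summit.BirchSwinnertonDyer.BirchSwinnertonDyer.Rank1Residual

end
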